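import Summits.QuantumFields.YangMills.Theorems.UnitScaleTiltProp7CombTildRem2HMcomb2T3
import Summits.QuantumFields.YangMills.Theorems.UnitScaleTiltProp7LinearTowerDuhamel
import HarnessLib

/-!
# Route `UnitScaleTilt`, crux K1 «MinimiserStabilityRegPr» (stmt-QuantumFields-19200), route-R E′ (A′)-on-Σ, P-A2 (β), row `hMcomb₂` ⟸ H2-1(E) — file H-4b (member)
# «THE TIED-SOURCE INTERFACE OF H2-1(E)»: at a printed-regular background, for ANY propagator family `P_{l←i}` of the cornered true derivatives and ANY finite set `Z` of coarse bonds,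
# **`Σ_{(z,κ)∈Z}‖E_l(z,κ)‖ ≤ Σ_{Z}‖P_{l←0}(E_0)‖ + Σ_{j<l}Σ_{Z}‖P_{l←j+1}(s_j)‖`**, `s_j := E_{j+1} − T_j(E_j)` with **`‖s_j(z,κ)‖ ≤ 260·((2d+2)L)²·M₂,j(z,κ)`** (`j < K − n`) and
# `E_0 = e^{(iX)♯} − 1 − (iX)♯` — H-4's Duhamel at the member letters of H-3c

Cell `ym3-torus` (HUMAN RULING D-0037: YM₃ on the torus is ladder rung R3 — not d = 4, not a mass gap, not Clay), width seat `ym3-torus-px17` (gen 4); ★★OWNER RULINGS №20 (1) (`hMcomb₂`),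
№22 (c); ★routeR-w1 g9 07:08:36Z.  `--supports stmt-QuantumFields-19200 --as helper`; THEOREMS ONLY (0 `def`, 0 `sorry`); count-neutral.  «route-internal row (n3)-comb₂ — NOT N06,
NOT a print row; OPEN».  Nothing of `hMcomb`, `hMcomb₂`, H2-1, (β), `hPA2`, `hcoS`, E′, EX, the crux, d = 4 or the gap is claimed.

THE POINT.  H-3c ✓∕⧗`Prop7CombTildRem2HMcomb2T3.hMcomb₂_of_rem2L1` displays ONE row, H2-1(E): `∀ l < K − n, Σ_{ẑ ∈ cell_l}Σ_κ‖E_l(ẑ,κ)‖ ≤ Am₂(Lˡ)⁻¹ + Bm₂Lˡ`, where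
`E_l := (Ũˡ − 1) − Q l (iX)♯` and (H-3c §1) `‖E_{l+1}(z,κ) − T_l(E_l)(L•z,κ)‖ ≤ 260·((2d+2)L)²·M₂,l(z,κ)`.  H-4 ✓∕⧗`Prop7LinearTowerDuhamel` turns any such tower into a superposition
of HOMOGENEOUS propagations — the objects the `ℓ¹` knits bound (px18 g4 ✓∕⧗`Prop7CornerCombFlatL1Localised.sum_norm_cornerComb_le_localised` for the flat tower; ★routeR-w1's F-6 for
the dressing).  This file instantiates H-4 at the member letters: the one-step maps `T_k f := (z, κ) ↦ T_k(f)(L•z, κ)` (the cornered true derivative at `Ū₀ᵏ♯`, written out; additive by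
★routeR-w1 ✓`Prop7CornerCombStructure.trueStep_add`), ANY two-index family `P` with the propagator texts (existence: H-4 `exists_propagator`), ANY finite set `Z` of level-`l` coarse
bonds (the period cell `{(lift ẑ, κ)}` of `hMcomb₂` is one such), and records the pointwise domination of the sources by H-3c §1 and the level-0 defect `E_0 = e^{(iX)♯} − 1 − (iX)♯`.
So **H2-1(E) ⟸ per-(l, j) `ℓ¹` bounds of `P_{l←j+1}` on two-block-dominated fields + of `P_{l←0}` on `e^{B} − 1 − B`** — nothing else.

WHAT IS PROVED (ns `…Theorems.Prop7CombTildRem2DuhamelT3`): `trueStepField_add` (additivity of the field-valued one-step maps), `rem2_field_zero` (`E_0` pointwise),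
★★★ `sum_norm_rem2_le_duhamel_of_regPr` (the title) and `norm_source_le_of_regPr` (the source domination in the `T`-letter of this file).
HONEST SCOPE.  Instantiation of H-4 + H-3c; no estimate of any propagator; no cell tiling∕periodicity; H2-1 OPEN.  Rung R3, not Clay; YM gap NOT proved.

References: T. Bałaban, CMP **98** (1985) 17–51 [Balaban1985Averaging] ((42) p.23, (65)∕(68)∕(69) p.29, Prop. 3 (113)–(126) pp.34–36, (159)–(163) p.42); CMP **99** (1985) 75–102
[Balaban1985RegularSpaces] (Prop. 7 (1.139)–(1.141) p.100); CMP **102** (1985) 277–309 [Balaban1985Variational] ((19) p.281); CMP **109** (1987) 249–301 [Balaban1987RG1] ((0.4) p.253).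
-/

set_option autoImplicit false

noncomputable section

open scoped BigOperators Matrix.Norms.L2Operator

namespace Summit.QuantumFields.YangMills.Theorems.Prop7CombTildRem2DuhamelT3

open NormedSpace
open Literature.MathematicalPhysics.QuantumFieldTheory.Balaban1983to89
open Literature.MathematicalPhysics.QuantumFieldTheory.Balaban1983to89.T3ContinuumYM3Torus
open T3PrintedRegularMinimiser (RegPr)
open T3SectALandauChart (bgUnits)
open ExpMeanLog (eml)
open B7Prop1Explicit renaming Site → LSite
open B7Prop1Explicit (e seg boxVec gammaWord Wcx Xavg expUnit)
open B7Prop2Explicit (avgIter)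
open B7Prop3Flat (expCfg)
open B7Eq92Concrete (tildIter tildIter_zero')
open B7Prop3GeneralRotated (tsum)
open B10Eq27TorusAxialLog (pull transl)
open Summit.QuantumFields.YangMills.Theorems.Prop7SPrint (basePt)
open Summit.QuantumFields.YangMills.Theorems.Prop7TPrint (nMax19)
open Summit.QuantumFields.YangMills.Theorems.Prop7CornerCombStructure (trueStep_add)
open Summit.QuantumFields.YangMills.Theorems.Prop7CombTildRem2HMcomb2T3 (norm_rem2_succ_sub_trueStep_le_of_regPr')
open Summit.QuantumFields.YangMills.Theorems.Prop7LinearTowerDuhamel (sum_norm_le_of_duhamel₂)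

section Member

variable (F : T3Family) {n K : ℕ}

/-- **The field-valued cornered one-step maps are additive**: `T_k(f + g) = T_k f + T_k g` for `T_k f := (z,κ) ↦ T_k(f)(L•z, κ)` (★routeR-w1 ✓`trueStep_add` at every coarse bond).
[cite: Balaban1985Averaging, (119)-(122) pp.35-36] -/
theorem trueStepField_add (W : GaugeField (F.P K) 0 (Matrix.specialUnitaryGroup (Fin 2) ℂ)) (k : ℕ)
    (f g : LSite (F.P K).d → Fin (F.P K).d → Matrix (Fin 2) (Fin 2) ℂ) :
    letI : CStarAlgebra (Matrix (Fin 2) (Fin 2) ℂ) := B10Eq29TubeLine.cstarAlgebraMatrix 2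
    (fun (z : LSite (F.P K).d) (κ : Fin (F.P K).d) =>
      fderiv ℂ (eml : ((Fin (F.P K).d → Fin (F.P K).L) → Matrix (Fin 2) (Fin 2) ℂ) → Matrix (Fin 2) (Fin 2) ℂ)
          (fun r => ((Wcx (F.P K).L (avgIter (F.P K).L (pull (bgUnits F K W) (basePt F n K)) k) (((F.P K).L : ℤ) • z) κ (boxVec (F.P K).L r) :
            (Matrix (Fin 2) (Fin 2) ℂ)ˣ) : Matrix (Fin 2) (Fin 2) ℂ))
          (fun r => tsum (avgIter (F.P K).L (pull (bgUnits F K W) (basePt F n K)) k) (f + g) (((F.P K).L : ℤ) • z)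
              (gammaWord (F.P K).L κ (boxVec (F.P K).L r) ++ seg κ (-((F.P K).L : ℤ)))
            * ((Wcx (F.P K).L (avgIter (F.P K).L (pull (bgUnits F K W) (basePt F n K)) k) (((F.P K).L : ℤ) • z) κ (boxVec (F.P K).L r) :
                (Matrix (Fin 2) (Fin 2) ℂ)ˣ) : Matrix (Fin 2) (Fin 2) ℂ))
          * (((expUnit (Xavg (F.P K).L (avgIter (F.P K).L (pull (bgUnits F K W) (basePt F n K)) k) (((F.P K).L : ℤ) • z) κ))⁻¹ :
              (Matrix (Fin 2) (Fin 2) ℂ)ˣ) : Matrix (Fin 2) (Fin 2) ℂ)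
        + ((expUnit (Xavg (F.P K).L (avgIter (F.P K).L (pull (bgUnits F K W) (basePt F n K)) k) (((F.P K).L : ℤ) • z) κ) : (Matrix (Fin 2) (Fin 2) ℂ)ˣ) :
              Matrix (Fin 2) (Fin 2) ℂ)
            * tsum (avgIter (F.P K).L (pull (bgUnits F K W) (basePt F n K)) k) (f + g) (((F.P K).L : ℤ) • z) (seg κ ((F.P K).L : ℤ))
          * (((expUnit (Xavg (F.P K).L (avgIter (F.P K).L (pull (bgUnits F K W) (basePt F n K)) k) (((F.P K).L : ℤ) • z) κ))⁻¹ :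
              (Matrix (Fin 2) (Fin 2) ℂ)ˣ) : Matrix (Fin 2) (Fin 2) ℂ))
      = (fun (z : LSite (F.P K).d) (κ : Fin (F.P K).d) =>
          fderiv ℂ (eml : ((Fin (F.P K).d → Fin (F.P K).L) → Matrix (Fin 2) (Fin 2) ℂ) → Matrix (Fin 2) (Fin 2) ℂ)
              (fun r => ((Wcx (F.P K).L (avgIter (F.P K).L (pull (bgUnits F K W) (basePt F n K)) k) (((F.P K).L : ℤ) • z) κ (boxVec (F.P K).L r) :
                (Matrix (Fin 2) (Fin 2) ℂ)ˣ) : Matrix (Fin 2) (Fin 2) ℂ))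
              (fun r => tsum (avgIter (F.P K).L (pull (bgUnits F K W) (basePt F n K)) k) f (((F.P K).L : ℤ) • z)
                  (gammaWord (F.P K).L κ (boxVec (F.P K).L r) ++ seg κ (-((F.P K).L : ℤ)))
                * ((Wcx (F.P K).L (avgIter (F.P K).L (pull (bgUnits F K W) (basePt F n K)) k) (((F.P K).L : ℤ) • z) κ (boxVec (F.P K).L r) :
                    (Matrix (Fin 2) (Fin 2) ℂ)ˣ) : Matrix (Fin 2) (Fin 2) ℂ))
              * (((expUnit (Xavg (F.P K).L (avgIter (F.P K).L (pull (bgUnits F K W) (basePt F n K)) k) (((F.P K).L : ℤ) • z) κ))⁻¹ :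
                  (Matrix (Fin 2) (Fin 2) ℂ)ˣ) : Matrix (Fin 2) (Fin 2) ℂ)
            + ((expUnit (Xavg (F.P K).L (avgIter (F.P K).L (pull (bgUnits F K W) (basePt F n K)) k) (((F.P K).L : ℤ) • z) κ) : (Matrix (Fin 2) (Fin 2) ℂ)ˣ) :
                  Matrix (Fin 2) (Fin 2) ℂ)
                * tsum (avgIter (F.P K).L (pull (bgUnits F K W) (basePt F n K)) k) f (((F.P K).L : ℤ) • z) (seg κ ((F.P K).L : ℤ))
              * (((expUnit (Xavg (F.P K).L (avgIter (F.P K).L (pull (bgUnits F K W) (basePt F n K)) k) (((F.P K).L : ℤ) • z) κ))⁻¹ :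
                  (Matrix (Fin 2) (Fin 2) ℂ)ˣ) : Matrix (Fin 2) (Fin 2) ℂ))
        + (fun (z : LSite (F.P K).d) (κ : Fin (F.P K).d) =>
          fderiv ℂ (eml : ((Fin (F.P K).d → Fin (F.P K).L) → Matrix (Fin 2) (Fin 2) ℂ) → Matrix (Fin 2) (Fin 2) ℂ)
              (fun r => ((Wcx (F.P K).L (avgIter (F.P K).L (pull (bgUnits F K W) (basePt F n K)) k) (((F.P K).L : ℤ) • z) κ (boxVec (F.P K).L r) :
                (Matrix (Fin 2) (Fin 2) ℂ)ˣ) : Matrix (Fin 2) (Fin 2) ℂ))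
              (fun r => tsum (avgIter (F.P K).L (pull (bgUnits F K W) (basePt F n K)) k) g (((F.P K).L : ℤ) • z)
                  (gammaWord (F.P K).L κ (boxVec (F.P K).L r) ++ seg κ (-((F.P K).L : ℤ)))
                * ((Wcx (F.P K).L (avgIter (F.P K).L (pull (bgUnits F K W) (basePt F n K)) k) (((F.P K).L : ℤ) • z) κ (boxVec (F.P K).L r) :
                    (Matrix (Fin 2) (Fin 2) ℂ)ˣ) : Matrix (Fin 2) (Fin 2) ℂ))
              * (((expUnit (Xavg (F.P K).L (avgIter (F.P K).L (pull (bgUnits F K W) (basePt F n K)) k) (((F.P K).L : ℤ) • z) κ))⁻¹ :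
                  (Matrix (Fin 2) (Fin 2) ℂ)ˣ) : Matrix (Fin 2) (Fin 2) ℂ)
            + ((expUnit (Xavg (F.P K).L (avgIter (F.P K).L (pull (bgUnits F K W) (basePt F n K)) k) (((F.P K).L : ℤ) • z) κ) : (Matrix (Fin 2) (Fin 2) ℂ)ˣ) :
                  Matrix (Fin 2) (Fin 2) ℂ)
                * tsum (avgIter (F.P K).L (pull (bgUnits F K W) (basePt F n K)) k) g (((F.P K).L : ℤ) • z) (seg κ ((F.P K).L : ℤ))
              * (((expUnit (Xavg (F.P K).L (avgIter (F.P K).L (pull (bgUnits F K W) (basePt F n K)) k) (((F.P K).L : ℤ) • z) κ))⁻¹ :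
                  (Matrix (Fin 2) (Fin 2) ℂ)ˣ) : Matrix (Fin 2) (Fin 2) ℂ)) := by
  letI : CStarAlgebra (Matrix (Fin 2) (Fin 2) ℂ) := B10Eq29TubeLine.cstarAlgebraMatrix 2
  funext z κ
  simp only [Pi.add_apply]
  exact trueStep_add (F.P K).L (avgIter (F.P K).L (pull (bgUnits F K W) (basePt F n K)) k) f g (((F.P K).L : ℤ) • z) κ

/-- **The level-0 defect pointwise**: `E_0(x, μ) = e^{iX⟨x₀+x, μ⟩} − 1 − iX⟨x₀+x, μ⟩` for any family `Q` with `Q 0 Y = Y` (lit ✓`tildIter_zero'`, `expCfg` unfolded).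
[cite: Balaban1985Averaging, (69) p.29] -/
theorem rem2_field_zero (W : GaugeField (F.P K) 0 (Matrix.specialUnitaryGroup (Fin 2) ℂ)) (X : PBond (F.P K) 0 → Matrix (Fin 2) (Fin 2) ℂ)
    (Q : ℕ → (LSite (F.P K).d → Fin (F.P K).d → Matrix (Fin 2) (Fin 2) ℂ) → LSite (F.P K).d → Fin (F.P K).d → Matrix (Fin 2) (Fin 2) ℂ) (hQ0 : ∀ Y, Q 0 Y = Y)
    (x : LSite (F.P K).d) (μ : Fin (F.P K).d) :
    (((tildIter (F.P K).L (pull (bgUnits F K W) (basePt F n K)) (expCfg fun x μ => Complex.I • X ⟨transl (basePt F n K) x, μ⟩) 0 x μ :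
          (Matrix (Fin 2) (Fin 2) ℂ)ˣ) : Matrix (Fin 2) (Fin 2) ℂ) - 1) - Q 0 (fun x μ => Complex.I • X ⟨transl (basePt F n K) x, μ⟩) x μ
      = NormedSpace.exp (Complex.I • X ⟨transl (basePt F n K) x, μ⟩) - 1 - Complex.I • X ⟨transl (basePt F n K) x, μ⟩ := by
  rw [tildIter_zero', hQ0]
  simp only [expCfg, B7Prop1Explicit.val_expUnit]

/-- ★★★ **THE TIED-SOURCE INTERFACE OF H2-1(E) AT A PRINTED-REGULAR BACKGROUND**: member `(F, n, K)`, `RegPr F n K ε₀ W`, `10⁷L⁴ε₀ ≤ 1`, Hermitian traceless `X` with `nMax19 W X < ε₀∕6`;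
`E_k := (Ũᵏ − 1) − Q k (iX)♯` for ANY `Q` with ✓p704390's text; `T_k f := (z,κ) ↦ T_k(f)(L•z, κ)` (written out); ANY `P` with the propagator texts `P i i = id`, `P (l+1) i = T_l ∘ P l i`
(`i ≤ l`); ANY finite set `Z` of coarse bonds.  THEN (H-4 ✓`sum_norm_le_of_duhamel₂`):
`Σ_{(z,κ)∈Z}‖E_l(z,κ)‖ ≤ Σ_{Z}‖P_{l←0}(E_0)(z,κ)‖ + Σ_{j<l}Σ_{Z}‖P_{l←j+1}(E_{j+1} − T_j E_j)(z,κ)‖`, AND for every `j < K − n` and every `(z,κ)` the source is two-block-dominated: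
`‖(E_{j+1} − T_j E_j)(z,κ)‖ ≤ 260·((2d+2)L)²·M₂,j(z,κ)` (H-3c §1). [cite: Balaban1985Averaging, (65)-(69) p.29, Prop. 3 (113)-(126) pp.34-36, (159)-(163) p.42; Balaban1985RegularSpaces, Prop. 7 (1.139)-(1.141) p.100; Balaban1985Variational, (19) p.281; Balaban1987RG1, (0.4) p.253] -/
theorem sum_norm_rem2_le_duhamel_of_regPr {ε₀ : ℝ} (hε₀ : 0 < ε₀) (hε : 10 ^ 7 * (F.L : ℝ) ^ 4 * ε₀ ≤ 1)
    (W : GaugeField (F.P K) 0 (Matrix.specialUnitaryGroup (Fin 2) ℂ)) (hreg : RegPr F n K ε₀ W)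
    (X : PBond (F.P K) 0 → Matrix (Fin 2) (Fin 2) ℂ) (hX : ∀ b, (X b).IsHermitian ∧ (X b).trace = 0) (hX6 : nMax19 F n K W X < ε₀ / 6)
    (Q : ℕ → (LSite (F.P K).d → Fin (F.P K).d → Matrix (Fin 2) (Fin 2) ℂ) → LSite (F.P K).d → Fin (F.P K).d → Matrix (Fin 2) (Fin 2) ℂ)
    (hQs : ∀ (k : ℕ) (Y : LSite (F.P K).d → Fin (F.P K).d → Matrix (Fin 2) (Fin 2) ℂ) (z : LSite (F.P K).d) (κ : Fin (F.P K).d),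
      letI : CStarAlgebra (Matrix (Fin 2) (Fin 2) ℂ) := B10Eq29TubeLine.cstarAlgebraMatrix 2
      Q (k + 1) Y z κ
        = fderiv ℂ (eml : ((Fin (F.P K).d → Fin (F.P K).L) → Matrix (Fin 2) (Fin 2) ℂ) → Matrix (Fin 2) (Fin 2) ℂ)
              (fun r => ((Wcx (F.P K).L (avgIter (F.P K).L (pull (bgUnits F K W) (basePt F n K)) k) (((F.P K).L : ℤ) • z) κ (boxVec (F.P K).L r) :
                (Matrix (Fin 2) (Fin 2) ℂ)ˣ) : Matrix (Fin 2) (Fin 2) ℂ))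
              (fun r => tsum (avgIter (F.P K).L (pull (bgUnits F K W) (basePt F n K)) k) (Q k Y) (((F.P K).L : ℤ) • z)
                  (gammaWord (F.P K).L κ (boxVec (F.P K).L r) ++ seg κ (-((F.P K).L : ℤ)))
                * ((Wcx (F.P K).L (avgIter (F.P K).L (pull (bgUnits F K W) (basePt F n K)) k) (((F.P K).L : ℤ) • z) κ (boxVec (F.P K).L r) :
                    (Matrix (Fin 2) (Fin 2) ℂ)ˣ) : Matrix (Fin 2) (Fin 2) ℂ))
              * (((expUnit (Xavg (F.P K).L (avgIter (F.P K).L (pull (bgUnits F K W) (basePt F n K)) k) (((F.P K).L : ℤ) • z) κ))⁻¹ :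
                  (Matrix (Fin 2) (Fin 2) ℂ)ˣ) : Matrix (Fin 2) (Fin 2) ℂ)
            + ((expUnit (Xavg (F.P K).L (avgIter (F.P K).L (pull (bgUnits F K W) (basePt F n K)) k) (((F.P K).L : ℤ) • z) κ) : (Matrix (Fin 2) (Fin 2) ℂ)ˣ) :
                  Matrix (Fin 2) (Fin 2) ℂ)
                * tsum (avgIter (F.P K).L (pull (bgUnits F K W) (basePt F n K)) k) (Q k Y) (((F.P K).L : ℤ) • z) (seg κ ((F.P K).L : ℤ))
              * (((expUnit (Xavg (F.P K).L (avgIter (F.P K).L (pull (bgUnits F K W) (basePt F n K)) k) (((F.P K).L : ℤ) • z) κ))⁻¹ :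
                  (Matrix (Fin 2) (Fin 2) ℂ)ˣ) : Matrix (Fin 2) (Fin 2) ℂ))
    (T : ℕ → (LSite (F.P K).d → Fin (F.P K).d → Matrix (Fin 2) (Fin 2) ℂ) → LSite (F.P K).d → Fin (F.P K).d → Matrix (Fin 2) (Fin 2) ℂ)
    (hT : ∀ (k : ℕ) (f : LSite (F.P K).d → Fin (F.P K).d → Matrix (Fin 2) (Fin 2) ℂ) (z : LSite (F.P K).d) (κ : Fin (F.P K).d),
      letI : CStarAlgebra (Matrix (Fin 2) (Fin 2) ℂ) := B10Eq29TubeLine.cstarAlgebraMatrix 2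
      T k f z κ
        = fderiv ℂ (eml : ((Fin (F.P K).d → Fin (F.P K).L) → Matrix (Fin 2) (Fin 2) ℂ) → Matrix (Fin 2) (Fin 2) ℂ)
              (fun r => ((Wcx (F.P K).L (avgIter (F.P K).L (pull (bgUnits F K W) (basePt F n K)) k) (((F.P K).L : ℤ) • z) κ (boxVec (F.P K).L r) :
                (Matrix (Fin 2) (Fin 2) ℂ)ˣ) : Matrix (Fin 2) (Fin 2) ℂ))
              (fun r => tsum (avgIter (F.P K).L (pull (bgUnits F K W) (basePt F n K)) k) f (((F.P K).L : ℤ) • z)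
                  (gammaWord (F.P K).L κ (boxVec (F.P K).L r) ++ seg κ (-((F.P K).L : ℤ)))
                * ((Wcx (F.P K).L (avgIter (F.P K).L (pull (bgUnits F K W) (basePt F n K)) k) (((F.P K).L : ℤ) • z) κ (boxVec (F.P K).L r) :
                    (Matrix (Fin 2) (Fin 2) ℂ)ˣ) : Matrix (Fin 2) (Fin 2) ℂ))
              * (((expUnit (Xavg (F.P K).L (avgIter (F.P K).L (pull (bgUnits F K W) (basePt F n K)) k) (((F.P K).L : ℤ) • z) κ))⁻¹ :
                  (Matrix (Fin 2) (Fin 2) ℂ)ˣ) : Matrix (Fin 2) (Fin 2) ℂ)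
            + ((expUnit (Xavg (F.P K).L (avgIter (F.P K).L (pull (bgUnits F K W) (basePt F n K)) k) (((F.P K).L : ℤ) • z) κ) : (Matrix (Fin 2) (Fin 2) ℂ)ˣ) :
                  Matrix (Fin 2) (Fin 2) ℂ)
                * tsum (avgIter (F.P K).L (pull (bgUnits F K W) (basePt F n K)) k) f (((F.P K).L : ℤ) • z) (seg κ ((F.P K).L : ℤ))
              * (((expUnit (Xavg (F.P K).L (avgIter (F.P K).L (pull (bgUnits F K W) (basePt F n K)) k) (((F.P K).L : ℤ) • z) κ))⁻¹ :
                  (Matrix (Fin 2) (Fin 2) ℂ)ˣ) : Matrix (Fin 2) (Fin 2) ℂ))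
    (P : ℕ → ℕ → (LSite (F.P K).d → Fin (F.P K).d → Matrix (Fin 2) (Fin 2) ℂ) → LSite (F.P K).d → Fin (F.P K).d → Matrix (Fin 2) (Fin 2) ℂ)
    (hP0 : ∀ i f, P i i f = f) (hPs : ∀ l i f, i ≤ l → P (l + 1) i f = T l (P l i f))
    (l : ℕ) (Z : Finset (LSite (F.P K).d × Fin (F.P K).d)) :
    (∑ p ∈ Z, ‖(((tildIter (F.P K).L (pull (bgUnits F K W) (basePt F n K)) (expCfg fun x μ => Complex.I • X ⟨transl (basePt F n K) x, μ⟩) l p.1 p.2 :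
            (Matrix (Fin 2) (Fin 2) ℂ)ˣ) : Matrix (Fin 2) (Fin 2) ℂ) - 1) - Q l (fun x μ => Complex.I • X ⟨transl (basePt F n K) x, μ⟩) p.1 p.2‖
      ≤ ∑ p ∈ Z, ‖P l 0 (fun x μ => (((tildIter (F.P K).L (pull (bgUnits F K W) (basePt F n K)) (expCfg fun x μ => Complex.I • X ⟨transl (basePt F n K) x, μ⟩) 0 x μ :
              (Matrix (Fin 2) (Fin 2) ℂ)ˣ) : Matrix (Fin 2) (Fin 2) ℂ) - 1) - Q 0 (fun x μ => Complex.I • X ⟨transl (basePt F n K) x, μ⟩) x μ) p.1 p.2‖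
        + ∑ j ∈ Finset.range l, ∑ p ∈ Z,
            ‖P l (j + 1)
                ((fun x μ => (((tildIter (F.P K).L (pull (bgUnits F K W) (basePt F n K)) (expCfg fun x μ => Complex.I • X ⟨transl (basePt F n K) x, μ⟩) (j + 1) x μ :
                    (Matrix (Fin 2) (Fin 2) ℂ)ˣ) : Matrix (Fin 2) (Fin 2) ℂ) - 1) - Q (j + 1) (fun x μ => Complex.I • X ⟨transl (basePt F n K) x, μ⟩) x μ)
                  - T j (fun x μ => (((tildIter (F.P K).L (pull (bgUnits F K W) (basePt F n K)) (expCfg fun x μ => Complex.I • X ⟨transl (basePt F n K) x, μ⟩) j x μ :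
                    (Matrix (Fin 2) (Fin 2) ℂ)ˣ) : Matrix (Fin 2) (Fin 2) ℂ) - 1) - Q j (fun x μ => Complex.I • X ⟨transl (basePt F n K) x, μ⟩) x μ))
                p.1 p.2‖) ∧
    ∀ j : ℕ, j < K - n → ∀ (z : LSite (F.P K).d) (κ : Fin (F.P K).d),
      ‖((fun x μ => (((tildIter (F.P K).L (pull (bgUnits F K W) (basePt F n K)) (expCfg fun x μ => Complex.I • X ⟨transl (basePt F n K) x, μ⟩) (j + 1) x μ :
              (Matrix (Fin 2) (Fin 2) ℂ)ˣ) : Matrix (Fin 2) (Fin 2) ℂ) - 1) - Q (j + 1) (fun x μ => Complex.I • X ⟨transl (basePt F n K) x, μ⟩) x μ)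
            - T j (fun x μ => (((tildIter (F.P K).L (pull (bgUnits F K W) (basePt F n K)) (expCfg fun x μ => Complex.I • X ⟨transl (basePt F n K) x, μ⟩) j x μ :
              (Matrix (Fin 2) (Fin 2) ℂ)ˣ) : Matrix (Fin 2) (Fin 2) ℂ) - 1) - Q j (fun x μ => Complex.I • X ⟨transl (basePt F n K) x, μ⟩) x μ)) z κ‖
        ≤ 260 * (((2 * ((F.P K).d : ℝ) + 2) * ((F.P K).L : ℝ)) ^ 2
            * ∑ s : Fin (F.P K).d → Fin (F.P K).L, ∑ ν : Fin (F.P K).d,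
              (‖((tildIter (F.P K).L (pull (bgUnits F K W) (basePt F n K)) (expCfg fun x μ => Complex.I • X ⟨transl (basePt F n K) x, μ⟩) j
                    (((F.P K).L : ℤ) • z + boxVec (F.P K).L s) ν : (Matrix (Fin 2) (Fin 2) ℂ)ˣ) : Matrix (Fin 2) (Fin 2) ℂ) - 1‖ ^ 2
                + ‖((tildIter (F.P K).L (pull (bgUnits F K W) (basePt F n K)) (expCfg fun x μ => Complex.I • X ⟨transl (basePt F n K) x, μ⟩) j
                    (((F.P K).L : ℤ) • z + ((F.P K).L : ℤ) • e κ + boxVec (F.P K).L s) ν : (Matrix (Fin 2) (Fin 2) ℂ)ˣ) : Matrix (Fin 2) (Fin 2) ℂ) - 1‖ ^ 2)) := by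
  letI : CStarAlgebra (Matrix (Fin 2) (Fin 2) ℂ) := B10Eq29TubeLine.cstarAlgebraMatrix 2
  -- the field-valued one-step maps are additive
  have hTadd : ∀ (k : ℕ) (f g : LSite (F.P K).d → Fin (F.P K).d → Matrix (Fin 2) (Fin 2) ℂ), T k (f + g) = T k f + T k g := by
    intro k f g
    have hTf : T k f = fun z κ => T k f z κ := rfl
    funext z κ
    rw [Pi.add_apply, Pi.add_apply, hT k (f + g) z κ, hT k f z κ, hT k g z κ]
    exact trueStep_add (F.P K).L (avgIter (F.P K).L (pull (bgUnits F K W) (basePt F n K)) k) f g (((F.P K).L : ℤ) • z) κ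
  refine ⟨?_, fun j hj z κ => ?_⟩
  · exact sum_norm_le_of_duhamel₂ T hTadd P hP0 hPs
      (fun k x μ => (((tildIter (F.P K).L (pull (bgUnits F K W) (basePt F n K)) (expCfg fun x μ => Complex.I • X ⟨transl (basePt F n K) x, μ⟩) k x μ :
        (Matrix (Fin 2) (Fin 2) ℂ)ˣ) : Matrix (Fin 2) (Fin 2) ℂ) - 1) - Q k (fun x μ => Complex.I • X ⟨transl (basePt F n K) x, μ⟩) x μ) l Z
  · have h := norm_rem2_succ_sub_trueStep_le_of_regPr' F hε₀ hε W hreg X hX hX6 Q hQs hj z κ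
    rw [Pi.sub_apply, Pi.sub_apply, hT j]
    exact h

end Member

end Summit.QuantumFields.YangMills.Theorems.Prop7CombTildRem2DuhamelT3

end
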